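import Literature.NumberTheory.EllipticCurves.Sprung2012.LocalIwasawaModule
import Literature.NumberTheory.EllipticCurves.Kato2004.IwasawaCohomologyUniqueProofs
import Literature.NumberTheory.GaloisRepresentations.ConjugationDescent
import HarnessLib

/-!
# Route `ThetaPartnerAtTwo` (TP2), crux K3 `SignedKatoDivisibilityUpToAtTwo` (item stmt-BirchSwinnertonDyer-20308),
# line `colemanrat` v5 — GLUE OF LAYERWISE LOCAL PAIRINGS INTO THE MAP `col₀ : 𝐇¹_Γ(T_pW) → Hom(E(K_∞·K_v), ℤ_p)`,
# and its `Λ`-LINEARITY for Sprung's action `lambdaSMul` from GALOIS INVARIANCE of the pairings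

Width seat `bsd-wall-tp2-p2x-w2` g3 (cell `bsd-wall`). HONEST FRAMING: THEOREMS ONLY — no definition, no named fact, no
instance, no `sorry`; route-independent (no `Theses`/`Cruxes` import); closes no item; NOTHING is asserted about the local
Tate pairing itself: the layer pairings `pair n` are HYPOTHESES (abstract `ℤ_p`-linear maps). BSD is NOT proved by any of this.

## Why this file

The research residue of the registered stub (R2^ι) `stub_localRobustPackageTwoInv` (lead memo `G4-LEAD-v5.md` §3, points
package `…PointsPackage.lean`) is the map `col₀ : 𝐇¹ → Hom(E(ℚ_{2,∞}·ℚ_v), ℤ₂)` — the `T₂E`-adic local Tate pairing along the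
`ℤ₂`-tower — which the lead specifies as a DEFINITION ITEM (D): per layer `n` a bi-additive pairing
`⟨·,·⟩_n : H¹(ℚ_n, T_pW) × E(ℚ_n·ℚ_v) → ℤ_p` with
(P1) the projection formula `⟨cor x, Q⟩_n = ⟨x, Q⟩_{n+1}` and (P2) Galois invariance `⟨conj_σ x, σ Q⟩_n = ⟨x, Q⟩_n`,
«so that `I.proj` glue to a functional on `localTowerPointsOfEmb`» and «⇒ `col : I.H → P` is `Λ`-LINEAR for `moduleOfGenerator`
with the same `g`». This file proves those two «⇒» ONCE AND FOR ALL, for ANY family `pair n` of `ℤ_p`-linear maps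
`H¹(ℚ_n, T_pW) → Hom(E(ℚ_n·ℚ_v), ℤ_p)` (any prime `p`, any pinned `I : Kato2004.IwasawaH1Data W p κ γ`, any local field `E`
with `ι : ℚ̄ → Ē`): whoever constructs (D) gets `col₀` and its `Λ`-linearity by name.

## What is proved (`Λ = ℤ_p⟦T⟧`; `proj n = I.proj n`; layers `E_n = localLayerPointsOfEmb κ ι W n`, tower `E_∞ = localTowerPointsOfEmb κ ι W`)

* §1 `pair_proj_eq_of_le`, `pair_proj_eq` — under (P1), `⟨proj m x, Q⟩_m = ⟨proj n x, Q⟩_n` for `Q ∈ E_m ∩ E_n`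
  (`I.cores_proj`).
* §2 `exists_col` — under (P1) there is an additive `col₀ : I.H →+ (E_∞ →+ ℤ_p)` with `col₀ x |_{E_n} = ⟨proj n x, ·⟩_n` for
  all `n`; `col_unique` — it is unique (`E_∞ = ⋃ E_n`, `exists_mem_localLayerPointsOfEmb_of_mem_localTowerPointsOfEmb`).
* §3 `col_X_smul` — under (P2) for a local `g` with `κ(res g) = 1` (and `κ γ = 1`): `col₀ (T • x) = Θ_g (col₀ x) − col₀ x`
  (`Θ_g z = z ∘ g⁻¹`, `Sprung2012.twistEnd`), because `conj_γ = conj_{res g}` on `H¹(ℚ_n, T_pW)` (they differ by an element of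
  `Gal(ℚ̄/ℚ_∞) ≤ Gal(ℚ̄/ℚ_n)`, which acts trivially: `conjMap_eq_self_of_mem_one`); `col_C_smul` — `col₀ (C a • x) = a • col₀ x`;
  `pair_aeval_eq_aeval_col` — polynomials: `⟨r(conj_γ − 1) proj n x, Q⟩_n = (r(Θ_g − 1) col₀ x)(Q)`;
  **`col_smul_eq_lambdaSMul`** — `col₀ (f • x) = f • col₀ x` for EVERY `f ∈ Λ`, the right-hand side being Sprung's action
  `lambdaSMul κ ι W hg f` (`moduleOfGenerator`): both sides are computed at level `n` through a polynomial representative of `f`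
  modulo `ω_n` (`IwasawaH1Data.proj_smul`, `Sprung2012.lambdaSMul_apply_eq_aeval`).
* §4 `exists_col_linear` — packaged: `∃ col₀`, additive, `Λ`-compatible (`col₀ (f • x) = lambdaSMul … f (col₀ x)`), with the layer
  formula; the shape consumed by `KummerPoint.exists_pointsPackage_two` (`col := q ∘ col₀`).

References: [Kato2004Asterisque] §12.2 (p. 220), §17.13 (p. 279); [Sprung2012] §2 (p. 1486), Def. 3.1 (p. 1489), Def. 5.9 (p. 1495);
[Kobayashi2003] §8.5–8.6; [PerrinRiou1994Invent] §3.6.1 (the `Λ`-adic local pairing and its projection formula); [SerreLocalFields1979] VII §5 Prop. 3.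
-/

set_option autoImplicit false
-- the Theorems namespace of this sub repeats the summit name by design (D-0017 nested layout)
set_option linter.dupNamespace false

noncomputable section

open scoped Classical

namespace Summit.BirchSwinnertonDyer.BirchSwinnertonDyer.Theorems

namespace SignedKatoOffTwo.ColGlue

open Polynomial Field Literature.NumberTheory.GaloisRepresentations Literature.NumberTheory.EllipticCurves
  Literature.NumberTheory.EllipticCurves.Kobayashi2003 Literature.NumberTheory.EllipticCurves.Sprung2012
  Literature.NumberTheory.EllipticCurves.Kato2004 Literature.NumberTheory.EllipticCurves.Kato2004.EulerSystemValues ZpExtension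

variable {p : ℕ} [Fact p.Prime] {W : WeierstrassCurve ℚ} [W.IsElliptic] [ContinuousSMul ℤ_[p] (W.tateModule p)]
  {κ : ZpExtension ℚ p} {γ : absoluteGaloisGroup ℚ} (I : IwasawaH1Data W p κ γ)
  {E : Type} [Field E] [Algebra ℚ E] (ι : AlgebraicClosure ℚ →ₐ[ℚ] AlgebraicClosure E)
  (pair : ∀ n : ℕ, H1 (tateRep W p) (κ.layerSubgroup n) →ₗ[ℤ_[p]] (localLayerPointsOfEmb κ ι W n →+ ℤ_[p]))

/-! ## §1 Level independence under the projection formula (P1) -/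

/-- **Level independence, `m ≤ n`.** Under the projection formula (P1) `⟨cor x, Q⟩_n = ⟨x, Q⟩_{n+1}` (`Q ∈ E_n ⊆ E_{n+1}`),
the value `⟨proj m x, Q⟩_m` of a norm-compatible family `x ∈ 𝐇¹` at a point `Q` of layer `m` equals `⟨proj n x, Q⟩_n` for
every `n ≥ m` (`I.cores_proj`). [cite: Kato2004Asterisque, §12.2 (p. 220)] [cite: PerrinRiou1994Invent, §3.6.1] -/
theorem pair_proj_eq_of_le
    (hP1 : ∀ (n : ℕ) (x : H1 (tateRep W p) (κ.layerSubgroup (n + 1))) (Q : localPoints W E)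
      (hQ : Q ∈ localLayerPointsOfEmb κ ι W n),
      pair n (layerCores (tateRep W p) κ n x) ⟨Q, hQ⟩ =
        pair (n + 1) x ⟨Q, localLayerPointsOfEmb_mono κ ι W (Nat.le_succ n) hQ⟩)
    (x : I.H) {m n : ℕ} (hmn : m ≤ n) {Q : localPoints W E} (hQm : Q ∈ localLayerPointsOfEmb κ ι W m)
    (hQn : Q ∈ localLayerPointsOfEmb κ ι W n) :
    pair m (I.proj m x) ⟨Q, hQm⟩ = pair n (I.proj n x) ⟨Q, hQn⟩ := by
  induction n, hmn using Nat.le_induction with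
  | base => rfl
  | succ n hmn ih =>
    rw [ih (localLayerPointsOfEmb_mono κ ι W hmn hQm), ← I.cores_proj n x, hP1 n (I.proj (n + 1) x) Q]

/-- **Level independence** (any two layers containing `Q`). [cite: Kato2004Asterisque, §12.2 (p. 220)] -/
theorem pair_proj_eq
    (hP1 : ∀ (n : ℕ) (x : H1 (tateRep W p) (κ.layerSubgroup (n + 1))) (Q : localPoints W E)
      (hQ : Q ∈ localLayerPointsOfEmb κ ι W n),
      pair n (layerCores (tateRep W p) κ n x) ⟨Q, hQ⟩ =
        pair (n + 1) x ⟨Q, localLayerPointsOfEmb_mono κ ι W (Nat.le_succ n) hQ⟩)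
    (x : I.H) {m n : ℕ} {Q : localPoints W E} (hQm : Q ∈ localLayerPointsOfEmb κ ι W m)
    (hQn : Q ∈ localLayerPointsOfEmb κ ι W n) :
    pair m (I.proj m x) ⟨Q, hQm⟩ = pair n (I.proj n x) ⟨Q, hQn⟩ := by
  rcases le_total m n with h | h
  · exact pair_proj_eq_of_le I ι pair hP1 x h hQm hQn
  · exact (pair_proj_eq_of_le I ι pair hP1 x h hQn hQm).symm

/-! ## §2 The glued map `col₀ : 𝐇¹ → Hom(E(K_∞·K_v), ℤ_p)` -/

/-- **Glue.** Under (P1), the layer pairings of the projections of `x ∈ 𝐇¹_Γ(T_pW)` glue to ONE additive functional on the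
tower points `E(K_∞·K_v) = ⋃ₙ E(K_n·K_v)`, additively in `x`: there is `col₀ : I.H →+ (E_∞ →+ ℤ_p)` with
`col₀ x (Q) = ⟨proj n x, Q⟩_n` whenever `Q ∈ E_n`. (Value at `Q` := the pairing at the chosen level of `Q`,
`Sprung2012.level`; independent of the level by `pair_proj_eq`; additive in `Q` through a common layer,
`exists_mem_localLayerPointsOfEmb_pair`.) [cite: Kato2004Asterisque, §12.2 (p. 220), §17.13 (p. 279)]
[cite: Sprung2012, §2 p. 1486 and Lemma 7.10 (p. 1503)] [cite: PerrinRiou1994Invent, §3.6.1] -/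
theorem exists_col
    (hP1 : ∀ (n : ℕ) (x : H1 (tateRep W p) (κ.layerSubgroup (n + 1))) (Q : localPoints W E)
      (hQ : Q ∈ localLayerPointsOfEmb κ ι W n),
      pair n (layerCores (tateRep W p) κ n x) ⟨Q, hQ⟩ =
        pair (n + 1) x ⟨Q, localLayerPointsOfEmb_mono κ ι W (Nat.le_succ n) hQ⟩) :
    ∃ col : I.H →+ (localTowerPointsOfEmb κ ι W →+ ℤ_[p]),
      ∀ (n : ℕ) (x : I.H) (Q : localPoints W E) (hQ : Q ∈ localLayerPointsOfEmb κ ι W n),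
        col x ⟨Q, localLayerPointsOfEmb_le_localTowerPointsOfEmb κ ι W n hQ⟩ = pair n (I.proj n x) ⟨Q, hQ⟩ := by
  -- the functional attached to `x`
  have key : ∀ (x : I.H) (y : localTowerPointsOfEmb κ ι W) (n : ℕ)
      (hQ : (y : localPoints W E) ∈ localLayerPointsOfEmb κ ι W n),
      pair (level κ ι W y) (I.proj (level κ ι W y) x) ⟨y, mem_layer_level κ ι W y⟩ = pair n (I.proj n x) ⟨y, hQ⟩ :=
    fun x y n hQ ↦ pair_proj_eq I ι pair hP1 x (mem_layer_level κ ι W y) hQ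
  let colx : I.H → (localTowerPointsOfEmb κ ι W →+ ℤ_[p]) := fun x ↦
    { toFun := fun y ↦ pair (level κ ι W y) (I.proj (level κ ι W y) x) ⟨y, mem_layer_level κ ι W y⟩
      map_zero' := by
        rw [key x 0 0 (localLayerPointsOfEmb κ ι W 0).zero_mem]
        exact (pair 0 (I.proj 0 x)).map_zero
      map_add' := fun y y' ↦ by
        obtain ⟨N, hy, hy'⟩ := exists_mem_localLayerPointsOfEmb_pair κ ι W y.2 y'.2
        rw [key x y N hy, key x y' N hy', key x (y + y') N (add_mem hy hy')]
        exact (pair N (I.proj N x)).map_add ⟨y, hy⟩ ⟨y', hy'⟩ }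
  have hcolx : ∀ (x : I.H) (y : localTowerPointsOfEmb κ ι W),
      colx x y = pair (level κ ι W y) (I.proj (level κ ι W y) x) ⟨y, mem_layer_level κ ι W y⟩ := fun _ _ ↦ rfl
  refine ⟨{ toFun := colx, map_zero' := ?_, map_add' := fun x x' ↦ ?_ }, fun n x Q hQ ↦ ?_⟩
  · exact AddMonoidHom.ext fun y ↦ by
      rw [hcolx, map_zero, map_zero, AddMonoidHom.zero_apply, AddMonoidHom.zero_apply]
  · exact AddMonoidHom.ext fun y ↦ by
      rw [AddMonoidHom.add_apply, hcolx, hcolx, hcolx, map_add, map_add, AddMonoidHom.add_apply]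
  · exact key x ⟨Q, localLayerPointsOfEmb_le_localTowerPointsOfEmb κ ι W n hQ⟩ n hQ

/-- **Uniqueness of the glue**: two additive maps `𝐇¹ → Hom(E_∞, ℤ_p)` with the layer formula agree (every tower point lies
in some layer). [cite: Sprung2012, Lemma 7.10 (p. 1503)] -/
theorem col_unique {col col' : I.H →+ (localTowerPointsOfEmb κ ι W →+ ℤ_[p])}
    (hcol : ∀ (n : ℕ) (x : I.H) (Q : localPoints W E) (hQ : Q ∈ localLayerPointsOfEmb κ ι W n),
      col x ⟨Q, localLayerPointsOfEmb_le_localTowerPointsOfEmb κ ι W n hQ⟩ = pair n (I.proj n x) ⟨Q, hQ⟩)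
    (hcol' : ∀ (n : ℕ) (x : I.H) (Q : localPoints W E) (hQ : Q ∈ localLayerPointsOfEmb κ ι W n),
      col' x ⟨Q, localLayerPointsOfEmb_le_localTowerPointsOfEmb κ ι W n hQ⟩ = pair n (I.proj n x) ⟨Q, hQ⟩) :
    col = col' := by
  refine AddMonoidHom.ext fun x ↦ AddMonoidHom.ext fun y ↦ ?_
  obtain ⟨n, hn⟩ := exists_mem_localLayerPointsOfEmb_of_mem_localTowerPointsOfEmb κ ι W y.2
  exact (hcol n x y hn).trans (hcol' n x y hn).symm

/-! ## §3 `Λ`-linearity of `col₀` for Sprung's action, from Galois invariance (P2) -/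

section Linear

variable {I ι pair} {g : absoluteGaloisGroup E} {col : I.H →+ (localTowerPointsOfEmb κ ι W →+ ℤ_[p])}

/-- `conj_γ = conj_{res g}` on `H¹(ℚ_n, T_pW)` when `κ γ = 1 = κ (res g)`: the two differ by `(res g)⁻¹ γ ∈ Gal(ℚ̄/ℚ_∞) ≤
Gal(ℚ̄/ℚ_n)`, whose elements act trivially on `H¹(ℚ_n, ·)` (inner automorphisms). [cite: SerreLocalFields1979, VII §5 Prop. 3] -/
theorem conjMap_eq_conjMap_resGalOfEmb (hγ : κ.IsTopGenerator γ) (hg : κ.IsTopGenerator (resGalOfEmb ι g)) (n : ℕ)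
    (y : H1 (tateRep W p) (κ.layerSubgroup n)) :
    conjMap (tateRep W p).toTopRep (κ.layerSubgroup n) γ 1 y =
      conjMap (tateRep W p).toTopRep (κ.layerSubgroup n) (resGalOfEmb ι g) 1 y := by
  have hmem : (resGalOfEmb ι g)⁻¹ * γ ∈ κ.layerSubgroup n := by
    refine κ.kerSubgroup_le_layerSubgroup n ?_
    rw [mem_kerSubgroup, map_mul, map_inv]
    change (κ (resGalOfEmb ι g))⁻¹ * κ γ = 1
    rw [show κ (resGalOfEmb ι g) = Multiplicative.ofAdd 1 from hg, show κ γ = Multiplicative.ofAdd 1 from hγ,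
      inv_mul_cancel]
  conv_lhs => rw [show γ = resGalOfEmb ι g * ((resGalOfEmb ι g)⁻¹ * γ) by group]
  rw [← conjMap_conjMap, conjMap_eq_self_of_mem_one _ _ hmem]

/-- **The `T`-step: `col₀ (T • x) = Θ_g (col₀ x) − col₀ x`.** `T` acts on `𝐇¹` as `conj_γ − 1` (`proj_T_smul`), `conj_γ =
conj_{res g}` at every layer, and the INVARIANCE (P2) `⟨conj_{res g} y, g Q⟩_n = ⟨y, Q⟩_n` turns `conj_{res g}` into
`Q ↦ g⁻¹ Q`, i.e. into Sprung's twist `Θ_g z = z ∘ g⁻¹`. [cite: Sprung2012, §2 p. 1486 and Def. 3.1 (p. 1489)]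
[cite: Kato2004Asterisque, §12.2 (p. 220)] [cite: PerrinRiou1994Invent, §3.6.1] -/
theorem col_X_smul (hγ : κ.IsTopGenerator γ) (hg : κ.IsTopGenerator (resGalOfEmb ι g))
    (hP2 : ∀ (n : ℕ) (y : H1 (tateRep W p) (κ.layerSubgroup n)) (Q : localPoints W E)
      (hQ : Q ∈ localLayerPointsOfEmb κ ι W n),
      pair n (conjMap (tateRep W p).toTopRep (κ.layerSubgroup n) (resGalOfEmb ι g) 1 y)
        ⟨g • Q, smul_mem_localLayerPointsOfEmb κ ι W n g hQ⟩ = pair n y ⟨Q, hQ⟩)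
    (hcol : ∀ (n : ℕ) (x : I.H) (Q : localPoints W E) (hQ : Q ∈ localLayerPointsOfEmb κ ι W n),
      col x ⟨Q, localLayerPointsOfEmb_le_localTowerPointsOfEmb κ ι W n hQ⟩ = pair n (I.proj n x) ⟨Q, hQ⟩)
    (x : I.H) :
    col ((PowerSeries.X : IwasawaAlgebra p) • x) = twistEnd κ ι W g (col x) - col x := by
  refine AddMonoidHom.ext fun y ↦ ?_
  obtain ⟨n, hn⟩ := exists_mem_localLayerPointsOfEmb_of_mem_localTowerPointsOfEmb κ ι W y.2
  have hgn : g⁻¹ • (y : localPoints W E) ∈ localLayerPointsOfEmb κ ι W n := smul_mem_localLayerPointsOfEmb κ ι W n g⁻¹ hn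
  rw [AddMonoidHom.sub_apply, twistEnd_apply]
  change col _ ⟨(y : localPoints W E), localLayerPointsOfEmb_le_localTowerPointsOfEmb κ ι W n hn⟩ =
    col x ⟨g⁻¹ • (y : localPoints W E), localLayerPointsOfEmb_le_localTowerPointsOfEmb κ ι W n hgn⟩ -
      col x ⟨(y : localPoints W E), localLayerPointsOfEmb_le_localTowerPointsOfEmb κ ι W n hn⟩
  rw [hcol n _ _ hn, hcol n x _ hgn, hcol n x _ hn, I.proj_T_smul, map_sub, AddMonoidHom.sub_apply,
    conjMap_eq_conjMap_resGalOfEmb hγ hg]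
  congr 1
  -- invariance at the point `g⁻¹ y`: `⟨conj_{res g} y', g (g⁻¹ y)⟩ = ⟨y', g⁻¹ y⟩`
  have h := hP2 n (I.proj n x) (g⁻¹ • (y : localPoints W E)) hgn
  have hy : (⟨g • g⁻¹ • (y : localPoints W E), smul_mem_localLayerPointsOfEmb κ ι W n g hgn⟩ :
      localLayerPointsOfEmb κ ι W n) = ⟨(y : localPoints W E), hn⟩ := Subtype.ext (smul_inv_smul g _)
  rw [hy] at h
  exact h

/-- **The constants: `col₀ (C a • x) = a • col₀ x`** (`proj_C_smul` and `ℤ_p`-linearity of the layer pairings).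
[cite: Kato2004Asterisque, §12.2 (p. 220)] -/
theorem col_C_smul
    (hcol : ∀ (n : ℕ) (x : I.H) (Q : localPoints W E) (hQ : Q ∈ localLayerPointsOfEmb κ ι W n),
      col x ⟨Q, localLayerPointsOfEmb_le_localTowerPointsOfEmb κ ι W n hQ⟩ = pair n (I.proj n x) ⟨Q, hQ⟩)
    (a : ℤ_[p]) (x : I.H) :
    col ((PowerSeries.C a : IwasawaAlgebra p) • x) = a • col x := by
  refine AddMonoidHom.ext fun y ↦ ?_
  obtain ⟨n, hn⟩ := exists_mem_localLayerPointsOfEmb_of_mem_localTowerPointsOfEmb κ ι W y.2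
  change col _ ⟨(y : localPoints W E), localLayerPointsOfEmb_le_localTowerPointsOfEmb κ ι W n hn⟩ =
    a • col x ⟨(y : localPoints W E), localLayerPointsOfEmb_le_localTowerPointsOfEmb κ ι W n hn⟩
  rw [hcol n _ _ hn, hcol n x _ hn, I.proj_C_smul, map_smul, AddMonoidHom.smul_apply]

/-- **Polynomials**: `⟨r(conj_γ − 1) proj n x, Q⟩_n = (r(Θ_g − 1) (col₀ x))(Q)` for every `r ∈ ℤ_p[X]`, `Q ∈ E_n`
(induction on `r`: constants by linearity, the `X`-step by `col_X_smul` read at level `n` through `proj_T_smul`).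
[cite: Sprung2012, Def. 5.9 (p. 1495)] [cite: Kato2004Asterisque, §12.2 (p. 220)] -/
theorem pair_aeval_eq_aeval_col (hγ : κ.IsTopGenerator γ) (hg : κ.IsTopGenerator (resGalOfEmb ι g))
    (hP2 : ∀ (n : ℕ) (y : H1 (tateRep W p) (κ.layerSubgroup n)) (Q : localPoints W E)
      (hQ : Q ∈ localLayerPointsOfEmb κ ι W n),
      pair n (conjMap (tateRep W p).toTopRep (κ.layerSubgroup n) (resGalOfEmb ι g) 1 y)
        ⟨g • Q, smul_mem_localLayerPointsOfEmb κ ι W n g hQ⟩ = pair n y ⟨Q, hQ⟩)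
    (hcol : ∀ (n : ℕ) (x : I.H) (Q : localPoints W E) (hQ : Q ∈ localLayerPointsOfEmb κ ι W n),
      col x ⟨Q, localLayerPointsOfEmb_le_localTowerPointsOfEmb κ ι W n hQ⟩ = pair n (I.proj n x) ⟨Q, hQ⟩)
    (n : ℕ) (r : ℤ_[p][X]) (x : I.H) (Q : localPoints W E) (hQ : Q ∈ localLayerPointsOfEmb κ ι W n) :
    pair n (aeval ((conjMap (tateRep W p).toTopRep (κ.layerSubgroup n) γ 1).hom.toLinearMap - 1) r (I.proj n x))
        ⟨Q, hQ⟩ =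
      (aeval (twistEnd κ ι W g - 1) r (col x)) ⟨Q, localLayerPointsOfEmb_le_localTowerPointsOfEmb κ ι W n hQ⟩ := by
  -- both sides are `col₀ (r • x)` read at level `n`
  rw [← I.proj_coe_smul n r x, ← hcol n _ Q hQ]
  congr 1
  induction r using Polynomial.induction_on generalizing x with
  | C c => rw [Polynomial.coe_C, col_C_smul hcol, aeval_C, Module.algebraMap_end_apply]
  | add f₁ f₂ h₁ h₂ => rw [Polynomial.coe_add, add_smul, map_add, h₁, h₂, map_add, LinearMap.add_apply]
  | monomial k c hk =>
    rw [pow_succ, ← mul_assoc, Polynomial.coe_mul, Polynomial.coe_X, mul_smul, hk, col_X_smul hγ hg hP2 hcol]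
    conv_rhs => rw [map_mul, Module.End.mul_apply, aeval_X, LinearMap.sub_apply, Module.End.one_apply]

/-- **`col₀` is `Λ`-LINEAR for Sprung's action**: `col₀ (f • x) = f • col₀ x` for every `f ∈ Λ = ℤ_p⟦T⟧`, the right-hand side
being `Sprung2012.lambdaSMul κ ι W hg f (col₀ x)` (the `smul` of `moduleOfGenerator κ ι W hg`). Both sides are LEVELWISE: at a
point of layer `n`, `f` acts through any polynomial representative `r ≡ f (mod ω_n)` — on `𝐇¹` by `IwasawaH1Data.proj_smul`
(`ω_n` kills `H¹(ℚ_n, T_pW)`), on `Hom(E_∞, ℤ_p)` by `lambdaSMul_apply_eq_aeval` — and for polynomials the two agree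
(`pair_aeval_eq_aeval_col`). No continuity is used. [cite: Sprung2012, §2 p. 1486 and Def. 5.9 (p. 1495)]
[cite: Kato2004Asterisque, §12.2 (p. 220), §17.13 (p. 279)] [cite: PerrinRiou1994Invent, §3.6.1] -/
theorem col_smul_eq_lambdaSMul (hγ : κ.IsTopGenerator γ) (hg : κ.IsTopGenerator (resGalOfEmb ι g))
    (hP2 : ∀ (n : ℕ) (y : H1 (tateRep W p) (κ.layerSubgroup n)) (Q : localPoints W E)
      (hQ : Q ∈ localLayerPointsOfEmb κ ι W n),
      pair n (conjMap (tateRep W p).toTopRep (κ.layerSubgroup n) (resGalOfEmb ι g) 1 y)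
        ⟨g • Q, smul_mem_localLayerPointsOfEmb κ ι W n g hQ⟩ = pair n y ⟨Q, hQ⟩)
    (hcol : ∀ (n : ℕ) (x : I.H) (Q : localPoints W E) (hQ : Q ∈ localLayerPointsOfEmb κ ι W n),
      col x ⟨Q, localLayerPointsOfEmb_le_localTowerPointsOfEmb κ ι W n hQ⟩ = pair n (I.proj n x) ⟨Q, hQ⟩)
    (f : IwasawaAlgebra p) (x : I.H) :
    col (f • x) = lambdaSMul κ ι W hg f (col x) := by
  refine AddMonoidHom.ext fun y ↦ ?_
  obtain ⟨n, hn⟩ := exists_mem_localLayerPointsOfEmb_of_mem_localTowerPointsOfEmb κ ι W y.2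
  -- a polynomial representative of `f` modulo `ω_n`
  have hr := toIwasawa_dvd_sub_polyRep n f (p := p)
  have hfr : f - (polyRep p n f : PowerSeries ℤ_[p]) ∈
      Ideal.span {(((X + 1 : ℤ_[p][X]) ^ p ^ n - 1 : ℤ_[p][X]) : PowerSeries ℤ_[p])} := by
    rw [Ideal.mem_span_singleton, ← toIwasawa_cyclotomicOmega_eq_coe p n]
    exact hr
  change col (f • x) ⟨(y : localPoints W E), localLayerPointsOfEmb_le_localTowerPointsOfEmb κ ι W n hn⟩ =
    lambdaSMul κ ι W hg f (col x) ⟨(y : localPoints W E), localLayerPointsOfEmb_le_localTowerPointsOfEmb κ ι W n hn⟩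
  rw [lambdaSMul_apply_eq_aeval hg f (col x) hr hn, hcol n _ _ hn, I.proj_smul hγ n hfr x,
    pair_aeval_eq_aeval_col hγ hg hP2 hcol n _ x _ hn]

end Linear

/-! ## §4 Packaged: the `Λ`-compatible `col₀` from (P1) + (P2) -/

/-- **From layer pairings with (P1) and (P2) to the `Λ`-linear map `col₀ : 𝐇¹_Γ(T_pW) → Hom(E(K_∞·K_v), ℤ_p)`.** For any pinned
`I`, topological generator `γ` (`κ γ = 1`), local `g ∈ Γ_{K_v}` with `κ(res g) = 1`, and ANY family of `ℤ_p`-linear layer pairings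
`pair n : H¹(ℚ_n, T_pW) → Hom(E(ℚ_n·ℚ_v), ℤ_p)` satisfying the projection formula (P1) and the invariance (P2), there is an additive
`col₀` with the layer formula `col₀ x|_{E_n} = ⟨proj n x, ·⟩_n` and `col₀ (f • x) = lambdaSMul κ ι W hg f (col₀ x)` for all `f ∈ Λ`
(`Λ`-linear into `moduleOfGenerator κ ι W hg`) — the `col₀` of the points package (`col := q ∘ col₀` in
`KummerPoint.exists_pointsPackage_two`). What it does NOT supply: the pairings themselves (definition item (D)), reciprocity,
the explicit reciprocity law. [cite: Kato2004Asterisque, §12.2 (p. 220), §17.13 (p. 279)] [cite: Sprung2012, Def. 5.9 (p. 1495)]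
[cite: PerrinRiou1994Invent, §3.6.1] -/
theorem exists_col_linear (hγ : κ.IsTopGenerator γ) {g : absoluteGaloisGroup E}
    (hg : κ.IsTopGenerator (resGalOfEmb ι g))
    (hP1 : ∀ (n : ℕ) (x : H1 (tateRep W p) (κ.layerSubgroup (n + 1))) (Q : localPoints W E)
      (hQ : Q ∈ localLayerPointsOfEmb κ ι W n),
      pair n (layerCores (tateRep W p) κ n x) ⟨Q, hQ⟩ =
        pair (n + 1) x ⟨Q, localLayerPointsOfEmb_mono κ ι W (Nat.le_succ n) hQ⟩)
    (hP2 : ∀ (n : ℕ) (y : H1 (tateRep W p) (κ.layerSubgroup n)) (Q : localPoints W E)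
      (hQ : Q ∈ localLayerPointsOfEmb κ ι W n),
      pair n (conjMap (tateRep W p).toTopRep (κ.layerSubgroup n) (resGalOfEmb ι g) 1 y)
        ⟨g • Q, smul_mem_localLayerPointsOfEmb κ ι W n g hQ⟩ = pair n y ⟨Q, hQ⟩) :
    ∃ col : I.H →+ (localTowerPointsOfEmb κ ι W →+ ℤ_[p]),
      (∀ (f : IwasawaAlgebra p) (x : I.H), col (f • x) = lambdaSMul κ ι W hg f (col x)) ∧
      ∀ (n : ℕ) (x : I.H) (Q : localPoints W E) (hQ : Q ∈ localLayerPointsOfEmb κ ι W n),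
        col x ⟨Q, localLayerPointsOfEmb_le_localTowerPointsOfEmb κ ι W n hQ⟩ = pair n (I.proj n x) ⟨Q, hQ⟩ := by
  obtain ⟨col, hcol⟩ := exists_col I ι pair hP1
  exact ⟨col, fun f x ↦ col_smul_eq_lambdaSMul hγ hg hP2 hcol f x, hcol⟩

end SignedKatoOffTwo.ColGlue

end Summit.BirchSwinnertonDyer.BirchSwinnertonDyer.Theorems

end
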